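import Summits.ValiantsHypothesis.ValiantsHypothesis.Theorems.BarrierLeverAnchoredDoorHitsLowerPairsAnchorSetsClosedForm

/-!
# Support item `AnchoredDoorHitsLowerPairs` (stmt-ValiantsHypothesis-22510), line `anchored-peeling`:
# the anchor-set expansion, part 3 — the subset (Cauchy–Binet) form and the UNIQUE-FAMILY CERTIFICATE

Helper file (`--supports stmt-ValiantsHypothesis-22510`; cell valiant-natproofs, rung V4, 𝒟-side door (c); registered line
`Cruxes/AnchoredDoorHitsLowerPairs/Lines/anchored_peeling.lean` v5; prover seat val-np-p4 gen 17). Bookkeeping `def`s `thetaCount`,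
`xcoeffT`, `ycoeffT`. Closes NO item. Continues `…AnchorSets` (p590167) and `…AnchorSetsClosedForm` (p590575).

* `symbolicDet_eq_sum_strictMono` (**Cauchy–Binet over `r`-subsets**): for any enumeration `e : Fin N ≃ ASet s h` of the anchor sets,
  `symbolicDet s h r u w = Σ_{t : Fin r → Fin N strictly increasing} θ^{m(t)} · det P[·, e∘t] · det Q[e∘t, ·]`,
  `θ^{m(t)} = ∏_i θ^{e (t i)}` — the symbolic minor is a sum over `r`-element FAMILIES of anchor sets of
  (θ-monomial of the family) × (one-sided `x`-minor) × (one-sided `y`-minor).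
* `sumAlgEquiv_symbolicDet` (**separating `θ` from the twists**): under `MvPolynomial.sumAlgEquiv` (θ-variables outside, twist
  variables as coefficients) the symbolic minor is `Σ_t monomial (thetaCount (e∘t)) (det P'[t] · det Q'[t])` with the TWIST-ONLY
  minors `P'`, `Q'` (`xcoeffT`, `ycoeffT`: the closed forms of part 2 read in the twist ring); `thetaCount` = the anchor MULTISET of
  the family (`α ↦ #{i : α ∈ e (t i)}`).
* `symbolicDet_ne_zero_of_unique_family` (**THE CERTIFICATE**): if some family `t₀` has `det P[·, e∘t₀] ≠ 0`, `det Q[e∘t₀, ·] ≠ 0`, and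
  every OTHER family `t` with the same anchor multiset has `det P[·, e∘t] · det Q[e∘t, ·] = 0`, then `symbolicDet s h r u w ≠ 0`
  (the coefficient of `θ^{m(t₀)}` is the single product `det P'[t₀] · det Q'[t₀] ≠ 0`). The distinct-anchor certificate of
  `…DistinctAnchors` is the case «all members singletons» (a squarefree multiset has only the singleton family); the new theorem
  also covers families with REPEATED anchors — the regime `r − 1 > #anchors` where every monomial repeats an anchor
  (memo HOME/val-np-p4/g17/MEMO-anchor-set-expansion-valnp4-g17.md §2(b), §7: at generic weight vectors the optimal multiset had a
  UNIQUE admissible family in every sampled lower pair, kit j295696).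
A family containing an anchor set `J` whose `x`-footprint is not a row (resp. `y`-footprint not a column) has a zero column of `P`
(resp. zero row of `Q`) — `xcoeff_eq_zero_of_not_subset`, `det_bigP_submatrix_eq_zero_of_not_mem` — so «every other family with the
same multiset contains an INADMISSIBLE member» discharges the uniqueness hypothesis combinatorially:
`symbolicDet_ne_zero_of_unique_admissible_family` (§10). General form: `symbolicDet_ne_zero_of_fiber_sum_ne_zero` (§11) — the
coefficient of `θ^{m₀}` is the sum of `det P · det Q` over the families with multiset `m₀`; nonzero sum ⇒ hit.

WHAT THIS IS NOT: a certificate FORMAT; nothing on which pairs are hit, on items 22510 / 19717 themselves, on crux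
stmt-ValiantsHypothesis-14610, or on `VP` versus `VNP`.
-/

set_option linter.dupNamespace false

namespace Summit.ValiantsHypothesis.ValiantsHypothesis.Theorems.BarrierLever.AnchoredPeeling

open Finset MvPolynomial
open Summit.ValiantsHypothesis.ValiantsHypothesis.Theorems.BarrierLever.BrickCalculus
  (pexpo pexpo_def pexpo_le_iff pexpo_sub pexpo_apply_castAdd pexpo_apply_natAdd)

noncomputable section

namespace AnchorSets

variable {h : ℕ}

/-! ## 7. Cauchy–Binet over `r`-subsets of anchor sets -/

section Subsets

variable (s h : ℕ)

/-- Restricting `P · D_θ` to the columns of a selection `f` factors the `θ`-monomials out. -/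
theorem bigP_mul_bigD_submatrix {r k : ℕ} (u : Fin r → Finset (Fin h)) (f : Fin k → ASet s h) :
    (bigP s h r u * bigD s h).submatrix id f = (bigP s h r u).submatrix id f * Matrix.diagonal fun i => thetaMon (f i).1 := by
  ext i j
  rw [Matrix.submatrix_apply, bigD, Matrix.mul_diagonal, Matrix.mul_diagonal, Matrix.submatrix_apply, id]

/-- **Cauchy–Binet over `r`-subsets.** For any enumeration `e` of the anchor sets, the symbolic minor is the sum over strictly
increasing selections `t : Fin r → Fin N` (i.e. over `r`-element families of anchor sets) of
`θ^{family} · det P[·, family] · det Q[family, ·]`. -/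
theorem symbolicDet_eq_sum_strictMono {N : ℕ} (e : Fin N ≃ ASet s h) (r : ℕ) (u w : Fin r → Finset (Fin h)) :
    symbolicDet s h r u w =
      ∑ t ∈ (univ : Finset (Fin r → Fin N)).filter (fun t => StrictMono t),
        (∏ i, thetaMon (e (t i)).1) *
          (((bigP s h r u).submatrix id (e ∘ t)).det * ((bigQ s h r w).submatrix (e ∘ t) id).det) := by
  have hmul : bigP s h r u * bigD s h * bigQ s h r w =
      (bigP s h r u * bigD s h).submatrix id e * (bigQ s h r w).submatrix e id := by
    rw [Matrix.submatrix_mul_equiv, Matrix.submatrix_id_id]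
  rw [symbolicDet_eq_det_mul, hmul, Literature.Analysis.TotalPositivity.det_mul_eq_sum_strictMono]
  refine Finset.sum_congr rfl (fun t _ => ?_)
  rw [Matrix.submatrix_submatrix, Matrix.submatrix_submatrix, Function.comp_id, bigP_mul_bigD_submatrix, Matrix.det_mul,
    Matrix.det_diagonal]
  simp only [Function.comp_apply]
  ring

end Subsets

/-! ## 8. Separating the `θ`-variables from the twists -/

section Separate

/-- The twist variables (the `φ`'s and `ψ`'s) as an index type of their own. -/
abbrev Twist (h : ℕ) : Type := ((Finset (Fin h) × Finset (Fin h)) × Fin h) ⊕ ((Finset (Fin h) × Finset (Fin h)) × Fin h)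

/-- The anchor MULTISET of a selection of anchor sets: `α ↦ #{i : α ∈ f i}`. -/
def thetaCount {k : ℕ} (f : Fin k → Finset (Finset (Fin h) × Finset (Fin h))) : (Finset (Fin h) × Finset (Fin h)) →₀ ℕ :=
  ∑ i, ∑ α ∈ f i, Finsupp.single α 1

open Classical in
/-- The closed form of `xcoeff` read in the twist ring (no `θ`-variables). -/
def xcoeffT (U : Finset (Fin h)) (J : Finset (Finset (Fin h) × Finset (Fin h))) : MvPolynomial (Twist h) ℂ :=
  if (J : Set (Finset (Fin h) × Finset (Fin h))).PairwiseDisjoint Prod.fst ∧ xFoot J ⊆ U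
  then ∏ b ∈ U \ xFoot J, ∑ α ∈ J, X (Sum.inl (α, b)) else 0

open Classical in
/-- The closed form of `ycoeff` read in the twist ring. -/
def ycoeffT (W : Finset (Fin h)) (J : Finset (Finset (Fin h) × Finset (Fin h))) : MvPolynomial (Twist h) ℂ :=
  if (J : Set (Finset (Fin h) × Finset (Fin h))).PairwiseDisjoint Prod.snd ∧ yFoot J ⊆ W
  then ∏ d ∈ W \ yFoot J, ∑ α ∈ J, X (Sum.inr (α, d)) else 0

/-- `xcoeff` is the twist-only polynomial `xcoeffT` placed in the parameter ring. -/
theorem rename_xcoeffT (U : Finset (Fin h)) (J : Finset (Finset (Fin h) × Finset (Fin h))) :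
    rename Sum.inr (xcoeffT U J) = xcoeff U J := by
  classical
  rw [xcoeff_eq, xcoeffT]
  split_ifs
  · simp only [map_prod, map_sum, rename_X]
  · rw [map_zero]

/-- `ycoeff` is the twist-only polynomial `ycoeffT` placed in the parameter ring. -/
theorem rename_ycoeffT (W : Finset (Fin h)) (J : Finset (Finset (Fin h) × Finset (Fin h))) :
    rename Sum.inr (ycoeffT W J) = ycoeff W J := by
  classical
  rw [ycoeff_eq, ycoeffT]
  split_ifs
  · simp only [map_prod, map_sum, rename_X]
  · rw [map_zero]

variable (s h : ℕ)

/-- Twist-only `P`. -/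
def bigPT (r : ℕ) (u : Fin r → Finset (Fin h)) : Matrix (Fin r) (ASet s h) (MvPolynomial (Twist h) ℂ) :=
  Matrix.of fun i J => xcoeffT (u i) J.1

/-- Twist-only `Q`. -/
def bigQT (r : ℕ) (w : Fin r → Finset (Fin h)) : Matrix (ASet s h) (Fin r) (MvPolynomial (Twist h) ℂ) :=
  Matrix.of fun J j => ycoeffT (w j) J.1

/-- `P` is the twist-only `P'` placed in the parameter ring. -/
theorem map_bigPT (r : ℕ) (u : Fin r → Finset (Fin h)) :
    (bigPT s h r u).map (rename (R := ℂ) Sum.inr) = bigP s h r u := by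
  refine Matrix.ext fun i J => ?_
  rw [Matrix.map_apply, bigPT, bigP, Matrix.of_apply, Matrix.of_apply]
  exact rename_xcoeffT _ _

/-- `Q` is the twist-only `Q'` placed in the parameter ring. -/
theorem map_bigQT (r : ℕ) (w : Fin r → Finset (Fin h)) :
    (bigQT s h r w).map (rename (R := ℂ) Sum.inr) = bigQ s h r w := by
  refine Matrix.ext fun J j => ?_
  rw [Matrix.map_apply, bigQT, bigQ, Matrix.of_apply, Matrix.of_apply]
  exact rename_ycoeffT _ _

/-- The one-sided minors are twist-only: `det P[·, f] = rename inr (det P'[·, f])`. -/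
theorem det_bigP_submatrix_eq {r : ℕ} (u : Fin r → Finset (Fin h)) (f : Fin r → ASet s h) :
    ((bigP s h r u).submatrix id f).det = rename Sum.inr (((bigPT s h r u).submatrix id f).det) := by
  rw [AlgHom.map_det, AlgHom.mapMatrix_apply, ← Matrix.submatrix_map, map_bigPT]

/-- Mirror statement for `Q`. -/
theorem det_bigQ_submatrix_eq {r : ℕ} (w : Fin r → Finset (Fin h)) (f : Fin r → ASet s h) :
    ((bigQ s h r w).submatrix f id).det = rename Sum.inr (((bigQT s h r w).submatrix f id).det) := by
  rw [AlgHom.map_det, AlgHom.mapMatrix_apply, ← Matrix.submatrix_map, map_bigQT]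

/-- `sumAlgEquiv` sends a twist-only polynomial to a constant. -/
theorem sumAlgEquiv_rename_inr (q : MvPolynomial (Twist h) ℂ) :
    sumAlgEquiv ℂ (Finset (Fin h) × Finset (Fin h)) (Twist h) (rename Sum.inr q) = C q := by
  have := DFunLike.congr_fun (sumAlgEquiv_comp_rename_inr (R := ℂ) (S₁ := Finset (Fin h) × Finset (Fin h)) (S₂ := Twist h)) q
  simpa [IsScalarTower.toAlgHom_apply, MvPolynomial.algebraMap_eq] using this

/-- `sumAlgEquiv` sends the `θ`-monomial of a selection to the monomial of its anchor multiset. -/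
theorem sumAlgEquiv_prod_thetaMon {k : ℕ} (f : Fin k → Finset (Finset (Fin h) × Finset (Fin h))) :
    sumAlgEquiv ℂ (Finset (Fin h) × Finset (Fin h)) (Twist h) (∏ i, thetaMon (f i)) = monomial (thetaCount f) 1 := by
  have hfac : ∀ i, sumAlgEquiv ℂ (Finset (Fin h) × Finset (Fin h)) (Twist h) (thetaMon (f i)) =
      monomial (∑ α ∈ f i, Finsupp.single α 1) 1 := fun i => by
    rw [thetaMon, map_prod, MvPolynomial.monomial_sum_one]
    exact Finset.prod_congr rfl (fun α _ => by rw [sumAlgEquiv_X_inl]; rfl)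
  rw [map_prod, thetaCount, Finset.prod_congr rfl (fun i _ => hfac i), MvPolynomial.monomial_sum_one]

/-- **The symbolic minor with `θ` separated from the twists:** a sum, over `r`-element families of anchor sets, of
`(monomial of the family's anchor multiset) × (twist-only x-minor · twist-only y-minor)`. -/
theorem sumAlgEquiv_symbolicDet {N : ℕ} (e : Fin N ≃ ASet s h) (r : ℕ) (u w : Fin r → Finset (Fin h)) :
    sumAlgEquiv ℂ (Finset (Fin h) × Finset (Fin h)) (Twist h) (symbolicDet s h r u w) =
      ∑ t ∈ (univ : Finset (Fin r → Fin N)).filter (fun t => StrictMono t),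
        monomial (thetaCount (fun i => (e (t i)).1))
          ((((bigPT s h r u).submatrix id (e ∘ t)).det) * (((bigQT s h r w).submatrix (e ∘ t) id).det)) := by
  rw [symbolicDet_eq_sum_strictMono s h e, map_sum]
  refine Finset.sum_congr rfl (fun t _ => ?_)
  rw [map_mul, sumAlgEquiv_prod_thetaMon, det_bigP_submatrix_eq, det_bigQ_submatrix_eq, ← map_mul, sumAlgEquiv_rename_inr,
    mul_comm, MvPolynomial.C_mul_monomial, mul_one]

end Separate

/-! ## 9. The unique-family certificate -/

/-- A column of `P` at an anchor set whose `x`-footprint is not contained in the row vanishes; in particular, on a lower row family,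
an anchor set whose `x`-footprint is not a row has a ZERO column. -/
theorem xcoeff_eq_zero_of_not_subset {U : Finset (Fin h)} {J : Finset (Finset (Fin h) × Finset (Fin h))} (hJ : ¬ xFoot J ⊆ U) :
    xcoeff U J = 0 := by
  classical
  rw [xcoeff_eq, if_neg (fun hc => hJ hc.2)]

/-- Mirror statement for `Q`. -/
theorem ycoeff_eq_zero_of_not_subset {W : Finset (Fin h)} {J : Finset (Finset (Fin h) × Finset (Fin h))} (hJ : ¬ yFoot J ⊆ W) :
    ycoeff W J = 0 := by
  classical
  rw [ycoeff_eq, if_neg (fun hc => hJ hc.2)]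

variable (s h : ℕ)

/-- **THE UNIQUE-FAMILY CERTIFICATE.** Let `e` enumerate the anchor sets and let `t₀` be a strictly increasing selection of `r` of
them (a family) whose one-sided minors `det P[·, e∘t₀]` and `det Q[e∘t₀, ·]` are both nonzero. If every OTHER family with the same
anchor multiset has `det P · det Q = 0`, then the symbolic minor is nonzero: the coefficient of `θ^{multiset}` is the single
nonzero product. -/
theorem symbolicDet_ne_zero_of_unique_family {N : ℕ} (e : Fin N ≃ ASet s h) {r : ℕ} (u w : Fin r → Finset (Fin h))
    (t₀ : Fin r → Fin N) (ht₀ : StrictMono t₀)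
    (hP : ((bigP s h r u).submatrix id (e ∘ t₀)).det ≠ 0) (hQ : ((bigQ s h r w).submatrix (e ∘ t₀) id).det ≠ 0)
    (huniq : ∀ t : Fin r → Fin N, StrictMono t → t ≠ t₀ →
      thetaCount (fun i => (e (t i)).1) = thetaCount (fun i => (e (t₀ i)).1) →
      ((bigP s h r u).submatrix id (e ∘ t)).det * ((bigQ s h r w).submatrix (e ∘ t) id).det = 0) :
    symbolicDet s h r u w ≠ 0 := by
  classical
  intro hzero
  have hinj : Function.Injective (rename (R := ℂ) (Sum.inr : Twist h → Param h)) := rename_injective _ Sum.inr_injective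
  -- the twist-only products
  set c : (Fin r → Fin N) → MvPolynomial (Twist h) ℂ :=
    fun t => (((bigPT s h r u).submatrix id (e ∘ t)).det) * (((bigQT s h r w).submatrix (e ∘ t) id).det) with hc
  have hc_rename : ∀ t, rename Sum.inr (c t) =
      ((bigP s h r u).submatrix id (e ∘ t)).det * ((bigQ s h r w).submatrix (e ∘ t) id).det := fun t => by
    rw [hc, map_mul, det_bigP_submatrix_eq, det_bigQ_submatrix_eq]
  have hct₀ : c t₀ ≠ 0 := by
    intro h0
    have := hc_rename t₀
    rw [h0, map_zero] at this
    exact mul_ne_zero hP hQ this.symm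
  have hct : ∀ t, StrictMono t → t ≠ t₀ → thetaCount (fun i => (e (t i)).1) = thetaCount (fun i => (e (t₀ i)).1) → c t = 0 :=
    fun t ht hne hm => hinj (by rw [hc_rename t, map_zero]; exact huniq t ht hne hm)
  -- read off the coefficient of `θ^{multiset of t₀}`
  have key := congrArg (fun q => coeff (thetaCount (fun i => (e (t₀ i)).1))
    (sumAlgEquiv ℂ (Finset (Fin h) × Finset (Fin h)) (Twist h) q)) hzero
  simp only [map_zero, coeff_zero] at key
  rw [sumAlgEquiv_symbolicDet s h e, coeff_sum, Finset.sum_eq_single_of_mem t₀ (Finset.mem_filter.mpr ⟨Finset.mem_univ _, ht₀⟩)]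
    at key
  · rw [coeff_monomial, if_pos rfl] at key
    exact hct₀ key
  · intro t ht hne
    rw [Finset.mem_filter] at ht
    rw [coeff_monomial]
    split_ifs with hm
    · exact hct t ht.2 hne hm
    · rfl

/-! ## 10. A combinatorial form of the uniqueness hypothesis (appended, val-np-p4 g17) -/

/-- On a LOWER row family, an anchor set whose `x`-footprint is not a row has a zero column of `P`:
every minor of `P` through that column vanishes. -/
theorem det_bigP_submatrix_eq_zero_of_not_mem {r : ℕ} (u : Fin r → Finset (Fin h)) (hlu : IsLowerSet (Set.range u))
    (f : Fin r → ASet s h) (i₀ : Fin r) (hJ : xFoot (f i₀).1 ∉ Set.range u) :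
    ((bigP s h r u).submatrix id f).det = 0 := by
  refine Matrix.det_eq_zero_of_column_eq_zero i₀ (fun i => ?_)
  rw [Matrix.submatrix_apply, id, bigP, Matrix.of_apply]
  exact xcoeff_eq_zero_of_not_subset (fun hsub => hJ (hlu hsub ⟨i, rfl⟩))

/-- Mirror statement: an anchor set whose `y`-footprint is not a column has a zero row of `Q`. -/
theorem det_bigQ_submatrix_eq_zero_of_not_mem {r : ℕ} (w : Fin r → Finset (Fin h)) (hlw : IsLowerSet (Set.range w))
    (f : Fin r → ASet s h) (i₀ : Fin r) (hJ : yFoot (f i₀).1 ∉ Set.range w) :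
    ((bigQ s h r w).submatrix f id).det = 0 := by
  refine Matrix.det_eq_zero_of_row_eq_zero i₀ (fun j => ?_)
  rw [Matrix.submatrix_apply, id, bigQ, Matrix.of_apply]
  exact ycoeff_eq_zero_of_not_subset (fun hsub => hJ (hlw hsub ⟨j, rfl⟩))

/-- **THE UNIQUE-ADMISSIBLE-FAMILY CERTIFICATE (combinatorial uniqueness).** On a lower pair `(u, w)`: if a family `t₀` has both
one-sided minors nonzero and every OTHER family with the same anchor multiset contains a member whose `x`-footprint is not a row or
whose `y`-footprint is not a column (an INADMISSIBLE member), then `symbolicDet s h r u w ≠ 0`. The uniqueness hypothesis is now a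
purely combinatorial statement about splittings of the multiset into admissible anchor sets. -/
theorem symbolicDet_ne_zero_of_unique_admissible_family {N : ℕ} (e : Fin N ≃ ASet s h) {r : ℕ} (u w : Fin r → Finset (Fin h))
    (hlu : IsLowerSet (Set.range u)) (hlw : IsLowerSet (Set.range w))
    (t₀ : Fin r → Fin N) (ht₀ : StrictMono t₀)
    (hP : ((bigP s h r u).submatrix id (e ∘ t₀)).det ≠ 0) (hQ : ((bigQ s h r w).submatrix (e ∘ t₀) id).det ≠ 0)
    (huniq : ∀ t : Fin r → Fin N, StrictMono t → t ≠ t₀ →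
      thetaCount (fun i => (e (t i)).1) = thetaCount (fun i => (e (t₀ i)).1) →
      ∃ i, xFoot (e (t i)).1 ∉ Set.range u ∨ yFoot (e (t i)).1 ∉ Set.range w) :
    symbolicDet s h r u w ≠ 0 := by
  refine symbolicDet_ne_zero_of_unique_family s h e u w t₀ ht₀ hP hQ (fun t ht hne hm => ?_)
  obtain ⟨i, hi | hi⟩ := huniq t ht hne hm
  · rw [det_bigP_submatrix_eq_zero_of_not_mem s h u hlu (e ∘ t) i hi, zero_mul]
  · rw [det_bigQ_submatrix_eq_zero_of_not_mem s h w hlw (e ∘ t) i hi, mul_zero]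

/-! ## 11. The general fiber-sum certificate (appended, val-np-p4 g17) -/

/-- **THE FIBER-SUM CERTIFICATE (general form).** For any anchor multiset `m₀`: if the sum, over all families `t` (strictly increasing
selections through the enumeration `e`) with anchor multiset `m₀`, of `det P[·, e∘t] · det Q[e∘t, ·]` is nonzero, then
`symbolicDet s h r u w ≠ 0` — that sum is exactly the coefficient of `θ^{m₀}`. `symbolicDet_ne_zero_of_unique_family` is the case of a
one-term sum; this form also covers fibers with several common bases whose one-sided products do not cancel. -/
theorem symbolicDet_ne_zero_of_fiber_sum_ne_zero {N : ℕ} (e : Fin N ≃ ASet s h) {r : ℕ} (u w : Fin r → Finset (Fin h))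
    (m₀ : (Finset (Fin h) × Finset (Fin h)) →₀ ℕ)
    (hsum : ∑ t ∈ ((univ : Finset (Fin r → Fin N)).filter (fun t => StrictMono t)).filter
        (fun t => thetaCount (fun i => (e (t i)).1) = m₀),
        ((bigP s h r u).submatrix id (e ∘ t)).det * ((bigQ s h r w).submatrix (e ∘ t) id).det ≠ 0) :
    symbolicDet s h r u w ≠ 0 := by
  classical
  intro hzero
  set c : (Fin r → Fin N) → MvPolynomial (Twist h) ℂ :=
    fun t => (((bigPT s h r u).submatrix id (e ∘ t)).det) * (((bigQT s h r w).submatrix (e ∘ t) id).det) with hc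
  have hc_rename : ∀ t, rename Sum.inr (c t) =
      ((bigP s h r u).submatrix id (e ∘ t)).det * ((bigQ s h r w).submatrix (e ∘ t) id).det := fun t => by
    rw [hc, map_mul, det_bigP_submatrix_eq, det_bigQ_submatrix_eq]
  have key := congrArg (fun q => coeff m₀ (sumAlgEquiv ℂ (Finset (Fin h) × Finset (Fin h)) (Twist h) q)) hzero
  simp only [map_zero, coeff_zero] at key
  rw [sumAlgEquiv_symbolicDet s h e, coeff_sum] at key
  simp only [coeff_monomial] at key
  rw [← Finset.sum_filter] at key
  -- `key : Σ_{t : m t = m₀} c t = 0`; push it through `rename inr`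
  apply hsum
  have := congrArg (rename (R := ℂ) (Sum.inr : Twist h → Param h)) key
  rw [map_sum, map_zero] at this
  rw [← this]
  refine Finset.sum_congr ?_ (fun t _ => (hc_rename t).symm)
  ext t
  simp only [Finset.mem_filter, Finset.mem_univ, true_and, eq_comm]

end AnchorSets

end

end Summit.ValiantsHypothesis.ValiantsHypothesis.Theorems.BarrierLever.AnchoredPeeling
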